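import Summits.ResolutionOfSingularities.ResolutionOfSingularities.Theorems.FrobeniusLadderFInjectiveMacaulayficationProp44T1Glue
import Literature.AlgebraicGeometry.Resolution.PointStepTrichotomyResidue
import Literature.AlgebraicGeometry.Resolution.AdaptedTauOneForms
import Literature.AlgebraicGeometry.Resolution.BlowupChartMembership
import HarnessLib

/-!
# Cossart–Piltant 2008, Prop. 4.4 — the T1 line under the FULL-CHAIN ring contract (OPTION R, critic R106): glue I

OURS (res-inputs-p-8b g2). The scheme side of CONTRACT v3 `false_of_fullChain_tau_one` (signature 7eb1570b387a6915): σ′ (res-inputs-p-6's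
`IsBlowup.pointStep_trichotomy_of_stalkTau_eq_one'`, p626364 + residue export) at a point `q = x′`, the exceptional ideal is principal
(`IsBlowup.isEffectiveCartier`), the weak transform as the colon by ANY generator, generators of one principal ideal differ by a unit, the chart
description of `𝔪 R′`, and the contract clause `hrat` («rational point of the `u_n`-chart») at a point step of the T1 chain.
AI-written; AI review weaker than expert review. `CossartPiltant2008_prop44`, T1 and the ring contract are NOT proved here;
resolution in dimension `≥ 4` / positive characteristic is NOT proved. No definitions, no named facts.
-/

noncomputable section

open CategoryTheory CategoryTheory.Limits AlgebraicGeometry TopologicalSpace IsLocalRing MvPolynomial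
open Literature.AlgebraicGeometry.Resolution Scheme.IdealSheafData

namespace Summit.ResolutionOfSingularities.ResolutionOfSingularities.Theorems

namespace CP2008Prop44

universe u

/-! ## Glue for the FULL-CHAIN contract (OPTION R, critic R106) -/

/-- σ′ = res-inputs-p-6's TREE THEOREM `IsBlowup.pointStep_trichotomy_of_stalkTau_eq_one'` (the trichotomy with the residue-field generation
clause `hκ` in the non-rational block) transported to a point `q = x′`. [cite: CossartPiltant2008, Lemma 4.3 (5)] -/
theorem sigma'_congr {X X' : Scheme.{u}} {π : X' ⟶ X} [IsLocallyNoetherian X] [IsLocallyNoetherian X']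
    {Y : Closeds X} (hπ : IsBlowup π (vanishingIdeal Y)) {J : X.IdealSheafData} {μ : ℕ} (hμ : 1 ≤ μ)
    {x' : X'} [IsRegularLocalRing (X.presheaf.stalk (π x'))]
    (hd : (maximalIdeal (X.presheaf.stalk (π x'))).spanFinrank = 3)
    {c : Fin 3 → X.presheaf.stalk (π x')} (hc : Ideal.span (Set.range c) = maximalIdeal _)
    (hcY : Ideal.span (Set.range c) = stalkIdeal (vanishingIdeal Y) (π x'))
    (hτ : stalkTau J (π x') μ = 1) (had : ∀ i, i ≠ 0 → IsAdapted c (stalkIdeal J (π x')) μ i)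
    (hnear : IsNear π (vanishingIdeal Y) J μ x') (q : X') (h : q = x')
    [IsRegularLocalRing (X'.presheaf.stalk q)] (hdq : (maximalIdeal (X'.presheaf.stalk q)).spanFinrank = 3) :
    -- (i)/(ii): rational in the `u₁`-chart — origin after the shear `u₂ ↦ u₂ − a u₁`
    (∃ (a : X.presheaf.stalk (π x')) (c' : Fin 3 → X'.presheaf.stalk q),
        c' 1 = (stalkMapCongr π x' q h) (c 1) ∧
        (stalkMapCongr π x' q h) (c 0) = (stalkMapCongr π x' q h) (c 1) * c' 0 ∧
        (stalkMapCongr π x' q h) (c 2 - a * c 1) = (stalkMapCongr π x' q h) (c 1) * c' 2 ∧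
        Ideal.span {c' 0, c' 1, c' 2} = maximalIdeal (X'.presheaf.stalk q) ∧
        Function.Surjective (ResidueField.map (stalkMapCongr π x' q h)) ∧
        stalkIdeal (controlledTransform π (vanishingIdeal Y) J μ) q =
          Submodule.colon ((stalkIdeal J (π x')).map (stalkMapCongr π x' q h))
            ({(stalkMapCongr π x' q h) (c 1) ^ μ} : Set (X'.presheaf.stalk q))) ∨
    -- (iii): non-rational in the `u₁`-chart
    (∃ (t : X'.presheaf.stalk q) (P : Polynomial (X.presheaf.stalk (π x')))
        (c' : Fin 3 → X'.presheaf.stalk q),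
        c' 1 = (stalkMapCongr π x' q h) (c 1) ∧
        (stalkMapCongr π x' q h) (c 0) = (stalkMapCongr π x' q h) (c 1) * c' 0 ∧
        (stalkMapCongr π x' q h) (c 2) = (stalkMapCongr π x' q h) (c 1) * t ∧
        P.Monic ∧ c' 2 = Polynomial.eval₂ (stalkMapCongr π x' q h) t P ∧
        2 ≤ (P.map (residue _)).natDegree ∧ Irreducible (P.map (residue _)) ∧
        (∀ G : Polynomial (X.presheaf.stalk (π x')),
          Polynomial.eval₂ (stalkMapCongr π x' q h) t G ∈ maximalIdeal (X'.presheaf.stalk q) ↔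
            P.map (residue _) ∣ G.map (residue _)) ∧
        Ideal.span {c' 0, c' 1, c' 2} = maximalIdeal (X'.presheaf.stalk q) ∧
        stalkIdeal (controlledTransform π (vanishingIdeal Y) J μ) q =
          Submodule.colon ((stalkIdeal J (π x')).map (stalkMapCongr π x' q h))
            ({(stalkMapCongr π x' q h) (c 1) ^ μ} : Set (X'.presheaf.stalk q)) ∧
        (∀ r : ResidueField (X'.presheaf.stalk q), ∃ G : Polynomial (X.presheaf.stalk (π x')),
          residue _ (Polynomial.eval₂ (stalkMapCongr π x' q h) t G) = r)) ∨
    -- (i′): the origin of the `u₂`-chart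
    (∃ c' : Fin 3 → X'.presheaf.stalk q,
        c' 2 = (stalkMapCongr π x' q h) (c 2) ∧
        (stalkMapCongr π x' q h) (c 0) = (stalkMapCongr π x' q h) (c 2) * c' 0 ∧
        (stalkMapCongr π x' q h) (c 1) = (stalkMapCongr π x' q h) (c 2) * c' 1 ∧
        Ideal.span {c' 0, c' 1, c' 2} = maximalIdeal (X'.presheaf.stalk q) ∧
        Function.Surjective (ResidueField.map (stalkMapCongr π x' q h)) ∧
        stalkIdeal (controlledTransform π (vanishingIdeal Y) J μ) q =
          Submodule.colon ((stalkIdeal J (π x')).map (stalkMapCongr π x' q h))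
            ({(stalkMapCongr π x' q h) (c 2) ^ μ} : Set (X'.presheaf.stalk q))) := by
  subst h
  simp only [stalkMapCongr_self]
  exact hπ.pointStep_trichotomy_of_stalkTau_eq_one' hμ hd hdq hc hcY hτ had hnear

/-- **The exceptional ideal is principal at every point of the blow-up** (`q = x′` form): the stalk of `𝓘_Y 𝒪_{X′}` at `x′` is generated by one
element (an effective Cartier divisor, `IsBlowup.isEffectiveCartier`). [cite: StacksProject, Tag 01WS] -/
theorem exists_map_stalkIdeal_centre_eq_span_congr {X X' : Scheme.{u}} {π : X' ⟶ X} {Y : Closeds X}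
    (hπ : IsBlowup π (vanishingIdeal Y)) {x' : X'} (q : X') (h : q = x') :
    ∃ g : X'.presheaf.stalk q, (stalkIdeal (vanishingIdeal Y) (π x')).map (stalkMapCongr π x' q h) = Ideal.span {g} := by
  subst h
  simp only [stalkMapCongr_self]
  rw [← stalkIdeal_comap_eq_map_stalkMap]
  obtain ⟨t, -, ht⟩ := hπ.isEffectiveCartier.exists_stalkIdeal_eq_span q
  exact ⟨t, ht⟩

/-- The stalk of the weak transform at `q = x′` is the colon by the `μ`-th power of ANY generator of the exceptional ideal. [cite: CossartPiltant2008, §4 (11)] -/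
theorem stalkIdeal_controlledTransform_eq_colon_of_map_eq_span_congr {X X' : Scheme.{u}} [IsLocallyNoetherian X] [IsLocallyNoetherian X']
    {π : X' ⟶ X} (Y : Closeds X) (J : X.IdealSheafData) (μ : ℕ) {x' : X'} (q : X') (h : q = x') (g : X'.presheaf.stalk q)
    (hg : (stalkIdeal (vanishingIdeal Y) (π x')).map (stalkMapCongr π x' q h) = Ideal.span {g}) :
    stalkIdeal (controlledTransform π (vanishingIdeal Y) J μ) q =
      Submodule.colon ((stalkIdeal J (π x')).map (stalkMapCongr π x' q h)) ({g ^ μ} : Set (X'.presheaf.stalk q)) := by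
  subst h
  simp only [stalkMapCongr_self] at hg ⊢
  rw [controlledTransform, stalkIdeal_colon, stalkIdeal_pow, stalkIdeal_comap_eq_map_stalkMap, stalkIdeal_comap_eq_map_stalkMap, hg,
    Ideal.span_singleton_pow]
  exact Submodule.colon_span

/-- In a domain, two generators of the same principal ideal differ by a unit (packaged as we use it). [folklore] -/
theorem exists_unit_mul_eq_of_span_singleton_eq {S : Type u} [CommRing S] [IsDomain S] {a b : S}
    (h : Ideal.span {a} = Ideal.span {b}) : ∃ e : Sˣ, a * e = b :=
  Ideal.span_singleton_eq_span_singleton.mp h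

/-- In a chart where every generator of `𝔪` becomes a multiple of `φ (c j)`, the extended maximal ideal is `(φ (c j))`. [folklore] -/
theorem map_maximalIdeal_eq_span_of_chart {S S' : Type u} [CommRing S] [CommRing S'] [IsLocalRing S] (φ : S →+* S')
    {c : Fin 3 → S} (hgen : Ideal.span {c 0, c 1, c 2} = maximalIdeal S) (j : Fin 3)
    (h : ∀ i, φ (c i) ∈ Ideal.span {φ (c j)}) : (maximalIdeal S).map φ = Ideal.span {φ (c j)} := by
  rw [← hgen, Ideal.map_span]
  apply le_antisymm
  · rw [Ideal.span_le]
    rintro _ ⟨r, hr, rfl⟩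
    simp only [Set.mem_insert_iff, Set.mem_singleton_iff] at hr
    rcases hr with rfl | rfl | rfl
    · exact h 0
    · exact h 1
    · exact h 2
  · rw [Ideal.span_le, Set.singleton_subset_iff]
    refine Ideal.subset_span ⟨c j, ?_, rfl⟩
    fin_cases j <;> simp

set_option maxHeartbeats 800000 in
/-- **Point step, case «rational point of the `u_n`-chart»** of the FULL-CHAIN contract (clause `hrat`), at level `n` of the T1 chain:
σ′ (p-6) on the adapted label `(y, u_n, w)`; the other two cases of the trichotomy contradict the label-free guard.
[cite: CossartPiltant2008, Lemma 4.3 (5); Prop. 4.4 (proof, p. 11)] -/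
theorem fullChain_hrat (Xs : ℕ → Scheme.{u})
    (hN : ∀ n, IsLocallyNoetherian (Xs n)) (hXreg : ∀ n, Scheme.IsRegular (Xs n))
    (π : ∀ n, Xs (n + 1) ⟶ Xs n) (Y : ∀ n, Closeds (Xs n)) (y : ∀ n, Xs (n + 1))
    (J : ∀ n, (Xs n).IdealSheafData) {μ : ℕ} (hμ : 1 ≤ μ)
    (hy : ∀ n, π (n + 1) (y (n + 1)) = y n)
    (hmem : ∀ n, π n (y n) ∈ (Y n : Set (Xs n)))
    (hcl : ∀ n, IsClosed ({π n (y n)} : Set (Xs n)))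
    (hYirr : ∀ n, IsIrreducible ((Y n : Closeds (Xs n)) : Set (Xs n)))
    (hYreg : ∀ n, Scheme.IsRegular (vanishingIdeal (Y n)).subscheme)
    (hYord : ∀ n, ∀ z ∈ (Y n : Set (Xs n)), idealOrder (J n) z = μ)
    (hπ : ∀ n, IsBlowup (π n) (vanishingIdeal (Y n)))
    (hJ : ∀ n, J (n + 1) = controlledTransform (π n) (vanishingIdeal (Y n)) (J n) μ)
    (hbd : ∀ n (z : Xs n), idealOrder (J n) z ≤ μ)
    (hcodim : ∀ n, ∀ z ∈ (J n).support, 1 < Order.coheight z)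
    (hd : ∀ n, (maximalIdeal ((Xs n).presheaf.stalk (π n (y n)))).spanFinrank = 3)
    (hnear : ∀ n, IsNear (π n) (vanishingIdeal (Y n)) (J n) μ (y n))
    (hτ : ∀ n, @stalkTau (Xs n) (J n) (π n (y n)) (hXreg n (π n (y n))) μ = 1)
    (hG : ∀ n, IsGRing ((Xs n).presheaf.stalk (π n (y n))))
    (hcoinc : ∀ n (z : Xs n), z ⤳ π n (y n) → idealOrder (J n) z = μ → z ∈ (Y n : Set (Xs n)))
    (n : ℕ) (hptn : (Y n : Set (Xs n)) = {π n (y n)}) (un : chainRing Xs π y n) (u' : chainRing Xs π y (n + 1))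
    (hEm : (maximalIdeal (chainRing Xs π y n)).map (chainMap Xs π y hy n) = Ideal.span {u'})
    (hu_ratn : Ideal.span {chainMap Xs π y hy n un} = Ideal.span {u'} → u' = chainMap Xs π y hy n un)
    (yv wv : chainRing Xs π y n) (hgen : Ideal.span {yv, un, wv} = maximalIdeal _)
    (had : ∀ G ∈ initialForms ![yv, un, wv] (chainIdeal Xs π y J n) μ, ∃ a : ResidueField (chainRing Xs π y n), G = C a * X 0 ^ μ)
    (hsurj0 : Function.Surjective (ResidueField.map (chainMap Xs π y hy n)))
    (hspan : Ideal.span {chainMap Xs π y hy n un} = Ideal.span {u'}) :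
    ∃ (a : chainRing Xs π y n) (y' w' : chainRing Xs π y (n + 1)),
      chainMap Xs π y hy n yv = chainMap Xs π y hy n un * y' ∧
      chainMap Xs π y hy n (wv - a * un) = chainMap Xs π y hy n un * w' ∧
      Ideal.span {y', chainMap Xs π y hy n un, w'} = maximalIdeal (chainRing Xs π y (n + 1)) := by
  classical
  haveI := hN
  haveI hR : ∀ n, IsRegularLocalRing (chainRing Xs π y n) := fun n => hXreg n _
  haveI hDom : ∀ n, IsDomain (chainRing Xs π y n) := fun n => isDomain_of_isRegularLocalRing _
  have _hG := hG; have _hbd := hbd; have _hmem := hmem; have _hYirr := hYirr; have _hcodim := hcodim; have _hcoinc := hcoinc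
  have _hYreg := hYreg; have _hYord := hYord; have _hJ := hJ; have _hur := hu_ratn
  have rangeFin3 : ∀ {α : Type u} (c : Fin 3 → α), Set.range c = {c 0, c 1, c 2} := by
    intro α c
    ext a
    simp only [Set.mem_range, Set.mem_insert_iff, Set.mem_singleton_iff]
    constructor
    · rintro ⟨i, rfl⟩
      fin_cases i
      · exact Or.inl rfl
      · exact Or.inr (Or.inl rfl)
      · exact Or.inr (Or.inr rfl)
    · rintro (h | h | h) <;> exact ⟨_, h.symm⟩
  have range3 : ∀ {α : Type u} (a b c : α), Set.range ![a, b, c] = {a, b, c} := by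
    intro α a b c
    rw [rangeFin3]; rfl
  have range2 : ∀ {α : Type u} (a b : α), Set.range ![a, b] = {a, b} := by
    intro α a b; ext t
    simp only [Set.mem_range, Set.mem_insert_iff, Set.mem_singleton_iff]
    constructor
    · rintro ⟨i, rfl⟩
      fin_cases i
      · exact Or.inl rfl
      · exact Or.inr rfl
    · rintro (h | h)
      · exact ⟨0, by simp [h]⟩
      · exact ⟨1, by simp [h]⟩
  have range1 : ∀ {α : Type u} (a : α), Set.range ![a] = {a} := fun a => by ext s; simp [eq_comm]
  have _r3 := @range3; have _r2 := @range2; have _r1 := @range1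
  have hdim : ∀ n, ringKrullDim (chainRing Xs π y n) = 3 := by
    intro n
    have h := (isRegularLocalRing_iff (chainRing Xs π y n)).mp inferInstance
    rw [hd n] at h
    exact_mod_cast h.symm
  have hτr : ∀ n (c : Fin 3 → chainRing Xs π y n), Ideal.span (Set.range c) = maximalIdeal _ →
      hironakaTauAt c (chainIdeal Xs π y J n) μ = 1 := by
    intro n c hc
    rw [chainIdeal, ← stalkTau_eq (J n) (π n (y n)) μ (hd n) c hc]
    exact hτ n
  have hpt_P : ∀ n, (Y n : Set (Xs n)) = {π n (y n)} → stalkIdeal (vanishingIdeal (Y n)) (π n (y n)) = maximalIdeal _ := by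
    intro n hn
    have hYn : Y n = ⟨{π n (y n)}, hcl n⟩ := Closeds.ext hn
    rw [hYn, stalkIdeal_vanishingIdeal_singleton (hcl n)]
  have hcM : chainMap Xs π y hy n = stalkMapCongr (π n) (y n) (π (n + 1) (y (n + 1))) (hy n) := rfl
  show ∃ (a : chainRing Xs π y n) (y' w' : chainRing Xs π y (n + 1)),
    chainMap Xs π y hy n yv = chainMap Xs π y hy n un * y' ∧
    chainMap Xs π y hy n (wv - a * un) = chainMap Xs π y hy n un * w' ∧
    Ideal.span {y', chainMap Xs π y hy n un, w'} = maximalIdeal (chainRing Xs π y (n + 1))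
  set c : Fin 3 → chainRing Xs π y n := ![yv, un, wv] with hc_def
  have hc3 : Ideal.span {c 0, c 1, c 2} = maximalIdeal _ := hgen
  have hc : Ideal.span (Set.range c) = maximalIdeal _ := by rw [hc_def, range3]; exact hgen
  have hcY : Ideal.span (Set.range c) = stalkIdeal (vanishingIdeal (Y n)) (π n (y n)) := by rw [hc, hpt_P _ hptn]
  have hadI : ∀ i, i ≠ 0 → IsAdapted c (chainIdeal Xs π y J n) μ i := bridge_isAdapted had
  rcases sigma'_congr (hπ n) hμ (hd n) hc hcY (hτ n) hadI (hnear n) (π (n + 1) (y (n + 1))) (hy n) (hd (n + 1)) with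
    ⟨a, c', h1, h0, h2, hgen', hsurj, -⟩ | ⟨t, Pq, c', h1, h0, ht, hmon, hP, hdeg, hirr, hres, hgen', -, hκ⟩ |
    ⟨c', h2, h0, h1, hgen', hsurj, -⟩
  · refine ⟨a, c' 0, c' 2, ?_, ?_, ?_⟩
    · rw [hcM]; simpa [hc_def] using h0
    · rw [hcM]; simpa [hc_def] using h2
    · rw [h1] at hgen'
      rw [hcM]
      simp only [hc_def, Matrix.cons_val_one, Matrix.cons_val_zero] at hgen'
      convert hgen' using 2
  · exact absurd hsurj0 (not_surjective_residueField_map_of_two_le_natDegree _ hdeg hres)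
  · exfalso
    have hmap2 : (maximalIdeal (chainRing Xs π y n)).map (chainMap Xs π y hy n) = Ideal.span {chainMap Xs π y hy n wv} := by
      rw [hcM]
      refine map_maximalIdeal_eq_span_of_chart _ hc3 2 (fun i => ?_)
      fin_cases i
      · simp only [hc_def, Fin.zero_eta, Matrix.cons_val_zero, Matrix.cons_val]
        rw [show (stalkMapCongr (π n) (y n) (π (n + 1) (y (n + 1))) (hy n)) yv = _ * c' 0 by simpa [hc_def] using h0]
        exact Ideal.mul_mem_right _ _ (Ideal.mem_span_singleton_self _)
      · simp only [hc_def, Fin.mk_one, Matrix.cons_val_one, Matrix.cons_val]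
        rw [show (stalkMapCongr (π n) (y n) (π (n + 1) (y (n + 1))) (hy n)) un = _ * c' 1 by simpa [hc_def] using h1]
        exact Ideal.mul_mem_right _ _ (Ideal.mem_span_singleton_self _)
      · exact Ideal.mem_span_singleton_self _
    -- `span{φ u} = span{u (n+1)} = 𝔪 R′ = span{φ w}` while `φ u = φ w · c′ 1`, `c′ 1 ∈ 𝔪′`
    have hc'1 : c' 1 ∈ maximalIdeal _ := hgen' ▸ Ideal.subset_span (by simp)
    have hwu : chainMap Xs π y hy n wv ∈ Ideal.span {chainMap Xs π y hy n un} := by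
      rw [hspan, ← hEm, hmap2]; exact Ideal.mem_span_singleton_self _
    obtain ⟨r, hr⟩ := Ideal.mem_span_singleton'.mp hwu
    have h1' : chainMap Xs π y hy n un = chainMap Xs π y hy n wv * c' 1 := by rw [hcM]; simpa [hc_def] using h1
    rw [h1'] at hr
    have hzero : chainMap Xs π y hy n wv = 0 := by
      have hunit : IsUnit (1 - r * c' 1) :=
        IsLocalRing.isUnit_one_sub_self_of_mem_nonunits _
          ((IsLocalRing.mem_maximalIdeal _).mp (Ideal.mul_mem_left _ r hc'1))
      have : chainMap Xs π y hy n wv * (1 - r * c' 1) = 0 := by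
        rw [mul_sub, mul_one, sub_eq_zero]
        calc chainMap Xs π y hy n wv = r * (chainMap Xs π y hy n wv * c' 1) := hr.symm
          _ = chainMap Xs π y hy n wv * (r * c' 1) := by ring
      exact (hunit.mul_left_eq_zero).mp this
    have h2' : c' 2 = 0 := by rw [h2, ← hcM]; simpa [hc_def] using hzero
    rw [h2', Set.pair_comm (c' 1) (0 : chainRing Xs π y (n + 1)), Set.insert_comm (c' 0) 0, Ideal.span,
      Submodule.span_insert_zero] at hgen'
    exact false_of_span_pair_eq_maximalIdeal hgen' (hd (n + 1))

end CP2008Prop44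

end Summit.ResolutionOfSingularities.ResolutionOfSingularities.Theorems

end
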